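import Summits.CriticalPhenomena.PercolationContinuityZ3.Theorems.PercNearOneGluingNoHeavyLowerTailSahiCombMasterFamily
import Summits.CriticalPhenomena.PercolationContinuityZ3.Theorems.SahiMasterFamilyResidualStep
import Summits.CriticalPhenomena.PercolationContinuityZ3.Theorems.SahiMasterFamilyTotalMeetStratum
import Summits.CriticalPhenomena.PercolationContinuityZ3.Theorems.PercNearOneGluingNoHeavyLowerTailSahiDefectExpansion

/-!
# The comb (tensor-Bernstein) hierarchy for Sahi's `E_k`, III: the `k → k+1` step AT THE COMB LEVEL off the residual class,
# every `k`; (M⁺-3) unconditionally on five strata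

Support file of the one-cut programme (crux `NoHeavyLowerTail`, stmt-CriticalPhenomena-4575; cell `prim-masterthm`, seat P3;
`run/shared/lean/prim/prim-masterthm/prim-masterthm-p3/HIERARCHY.md` §9).  Vocabulary: `CombPos`, `MasterFamilyCombPos k` = (M⁺-k)
(`…SahiCombPositivity`, `…SahiCombMasterFamily`); the law-level strata are those of `SahiMasterFamilyResidualStep` /
`SahiMasterFamilyTotalMeetStratum` (unit prim-masterthm-p4).

THE POINT.  Every proved all-`k` reduction of the law-level `k → k+1` step is an IDENTITY expressing `E_{k+3}(U)` as a sum of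
PRODUCTS of lower-order `E`'s, probabilities of events and defect moments — and products/sums of comb-positive functions are
comb-positive with multidegrees adding (`CombPos.mul`).  So the reductions lift verbatim from (M) to the strictly stronger (M⁺):
* (R4) COMPARABLE pair `U_j ⊆ U_i` — `E_{k+3}(U) = Σ_{l≠l₀} E_{k+2}(U_{−i}; U_l ↦ U_l ∩ U_i) + (1 − P(U_i))·E_{k+2}(U_{−i})`
  (`combPos_sahiE_ind_of_subset`, given (M⁺-(k+2)));
* (R3) INDEPENDENT member — `E_{k+3}(1_H, 1_U) = (k+1)·P(H)·E_{k+2}(1_U)` (`combPos_sahiE_ind_of_indepMember`, given (M⁺-(k+2)));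
* (R6) a deleted family in `Z_{k+2}` — `E_{k+3}(U) = Σ_l E_{k+2}(U_{−m}; U_l ↦ U_l ∩ U_m)` (`combPos_sahiE_ind_of_zeroFlag`, given (M⁺-(k+2)));
* (R7′) a member containing the intersection of ALL the others — the defect expansion of `…SahiDefectExpansion`
  (`combPos_sahiE_ind_of_totalMeet`, given (M⁺-j) for all `j ≤ k+2`);
* (R5₃) a CYLINDER member at order 3 — `E_3(1_P,1_A,1_B) = P(P)·[Cov(A^S,B^S) + P((A∩B)^S ∖ A∩B) + P(A^S∖A)·P(B^S∖B)]` with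
  `X^S = {ω | ω ∪ S ∈ X}` (`combPos_sahiE_three_cylinder`; the all-`k` cylinder rung needs Blinovsky's partition identity and is not done here).
ASSEMBLED, UNCONDITIONALLY AT ORDER 3 (`combPos_sahiE_three_of_not_residual`): (M⁺-3) — i.e. nonnegativity of a degree-3
tensor-Bernstein representation of `E_3(μ_p; 1_{U_0},1_{U_1},1_{U_2})`, the (★★) three-partition level of HIERARCHY §3 — holds on
every finite cube for every triple of increasing events with a comparable pair, or a cylinder member, or a member independent of
the other two, or two members determined by disjoint coordinate sets, or a member containing the intersection of the other two.
The RESIDUAL class (antichain, no cylinder, pairwise dependent, no member ⊇ the meet of the others) is where (M⁺-3) remains open;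
exhaustive integer censuses put it at the top corner for `m ≤ 5` (HIERARCHY §4).  HONEST FRAMING: nothing here asserts (M⁺-k) or
`C_k` for `k ≥ 3`. [this work]
-/

noncomputable section

open scoped Classical

namespace Summit.CriticalPhenomena.PercolationContinuityZ3.Theorems

open Finset Function
open scoped Nat
open Literature.Combinatorics.Sahi2008
open Literature.Probability.LatticeModels (prodBernoulli)
open Literature.Probability.Percolation (DeterminedBy determinedBy_iff)
open Literature.Probability.Percolation.DecisionTree (ind ind_of_mem ind_of_not_mem ind_nonneg)
open SahiComb

variable {ι : Type} [Fintype ι]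

/-! ### Moving a slot to the head, uniformly in the weight -/

/-- Moving slot `m` to the head by ONE permutation valid for every weight:
`E_{n+2}^μ(1_U) = E_{n+2}^μ(1_{U_m}, (1_{U_{m.succAbove (τ j)}})_j)` for all `μ`. [cite: LiebSahi2021, Def. 3.1 (symmetry of `E_n`)] -/
theorem exists_perm_forall_sahiE_ind_eq_cons {n : ℕ} (U : Fin (n + 2) → Set (Set ι)) (m : Fin (n + 2)) :
    ∃ τ : Equiv.Perm (Fin (n + 1)), ∀ μ : Set ι → ℝ,
      sahiE μ (n + 2) (fun j => ind (U j)) =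
        sahiE μ (n + 2) (Matrix.vecCons (ind (U m)) fun j => ind (U (m.succAbove (τ j)))) := by
  set σ : Equiv.Perm (Fin (n + 2)) := Equiv.swap 0 m with hσ_def
  obtain ⟨τ, hτ⟩ := exists_perm_succAbove_comp σ 0
  refine ⟨τ, fun μ => ?_⟩
  rw [← sahiE_ind_comp_perm μ σ U]
  congr 1
  funext j
  refine Fin.cases ?_ (fun l => ?_) j
  · simp [hσ_def]
  · rw [Matrix.cons_val_succ, ← Fin.succAbove_zero, hτ l]
    simp [hσ_def]

/-! ### (R4) the comparable stratum -/

/-- **(M⁺-(k+2)) ⇒ (M⁺-(k+3)) on the comparable stratum.**  GIVEN `MasterFamilyCombPos (k+2)`, a family of `k + 3` increasing events in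
which slot `i` contains slot `i.succAbove l₀` has `p ↦ E_{k+3}(μ_p; 1_U)` comb-positive at multidegree `k + 3`. [this work] -/
theorem combPos_sahiE_ind_of_subset {k : ℕ} (hN : MasterFamilyCombPos (k + 2)) (U : Fin (k + 3) → Set (Set ι))
    (hU : ∀ j, IsUpperSet (U j)) (i : Fin (k + 3)) (l₀ : Fin (k + 2)) (hsub : U (i.succAbove l₀) ⊆ U i) :
    CombPos (fun _ : ι => k + 3) (fun p => sahiE (bernoulliWeight p) (k + 3) (fun j => ind (U j))) := by
  have habs := ind_mul_ind_eq_of_subset hsub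
  have hmod : ∀ l : Fin (k + 2), CombPos (fun _ : ι => k + 2) (fun p => sahiE (bernoulliWeight p) (k + 2)
      (update (fun j => ind (U (i.succAbove j))) l (ind (U (i.succAbove l)) * ind (U i)))) := fun l => by
    refine (hN ι _ (isUpperSet_update_inter hU i l)).congr fun p => ?_
    rw [← ind_update_inter]
  have hdel : CombPos (fun _ : ι => k + 2) (fun p => sahiE (bernoulliWeight p) (k + 2) (fun j => ind (U (i.succAbove j)))) :=
    hN ι _ fun j => hU _
  have hdeg : (fun _ : ι => (1 : ℕ)) + (fun _ : ι => k + 2) = fun _ : ι => k + 3 := by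
    funext e; simp only [Pi.add_apply]; omega
  have hle : (fun _ : ι => k + 2) ≤ (fun _ : ι => k + 3) := fun _ => Nat.le_succ _
  have htot := ((CombPos.sum (univ.erase l₀) fun l _ => hmod l).mono hle).add
    ((combPos_one_sub_ex_ind (U i)).mul_of_eq hdel hdeg)
  refine htot.congr fun p => ?_
  exact sahiE_peel_eq_of_absorbed (bernoulliWeight p) (k + 1) (fun j => ind (U j)) i l₀ habs

/-- The same with the comparable pair given as `U_j ⊆ U_i`, `i ≠ j`. [this work] -/
theorem combPos_sahiE_ind_of_subset' {k : ℕ} (hN : MasterFamilyCombPos (k + 2)) (U : Fin (k + 3) → Set (Set ι))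
    (hU : ∀ j, IsUpperSet (U j)) {i j : Fin (k + 3)} (hij : j ≠ i) (hsub : U j ⊆ U i) :
    CombPos (fun _ : ι => k + 3) (fun p => sahiE (bernoulliWeight p) (k + 3) (fun j => ind (U j))) := by
  obtain ⟨l₀, hl₀⟩ := Fin.exists_succAbove_eq hij
  exact combPos_sahiE_ind_of_subset hN U hU i l₀ (hl₀ ▸ hsub)

/-! ### (R3) the independent-member stratum -/

/-- **(M⁺-(k+2)) ⇒ (M⁺-(k+3)) across an independent member.**  GIVEN `MasterFamilyCombPos (k+2)`, a family of `k + 3` increasing events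
whose member `U_m` is determined by a coordinate set `F` while all the others are determined by `Fᶜ` has `E_{k+3}` comb-positive at
multidegree `k + 3` (splitting `E_{k+3} = (k+1)·P(U_m)·E_{k+2}(U_{−m})`). [this work] -/
theorem combPos_sahiE_ind_of_indepMember {k : ℕ} (hN : MasterFamilyCombPos (k + 2)) (U : Fin (k + 3) → Set (Set ι))
    (hU : ∀ j, IsUpperSet (U j)) (m : Fin (k + 3)) (F : Finset ι) (hF : DeterminedBy (U m) (↑F : Set ι))
    (hFc : ∀ j, DeterminedBy (U (m.succAbove j)) (↑F : Set ι)ᶜ) :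
    CombPos (fun _ : ι => k + 3) (fun p => sahiE (bernoulliWeight p) (k + 3) (fun j => ind (U j))) := by
  obtain ⟨τ, hτ⟩ := exists_perm_forall_sahiE_ind_eq_cons U m
  have hA : CombPos (fun _ : ι => k + 2)
      (fun p => sahiE (bernoulliWeight p) (k + 2) (fun j => ind (U (m.succAbove (τ j))))) := hN ι _ fun j => hU _
  have hdeg : (fun _ : ι => (1 : ℕ)) + (fun _ : ι => k + 2) = fun _ : ι => k + 3 := by
    funext e; simp only [Pi.add_apply]; omega
  have htot := (((combPos_ex_ind (U m)).mul_of_eq hA hdeg).smul (Nat.cast_nonneg (k + 1) : (0 : ℝ) ≤ (k + 1 : ℕ)))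
  refine htot.congr fun p => ?_
  rw [hτ, sahiE_bernoulliWeight_ind_cons_eq_of_determinedBy p F hF (fun j => U (m.succAbove (τ j))) fun j => hFc (τ j),
    ← ex_bernoulliWeight_ind]
  push_cast
  ring

/-! ### (R6) a zero-flag deleted family -/

/-- **(M⁺-(k+2)) ⇒ (M⁺-(k+3)) on families with a zero-flag sub-family.**  GIVEN `MasterFamilyCombPos (k+2)`, if `U_{−m} ∈ Z_{k+2}` then
`E_{k+3}(U) = Σ_l E_{k+2}(U_{−m}; U_l ↦ U_l ∩ U_m)` is comb-positive at multidegree `k + 3`. [this work] -/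
theorem combPos_sahiE_ind_of_zeroFlag {k : ℕ} (hN : MasterFamilyCombPos (k + 2)) (U : Fin (k + 3) → Set (Set ι))
    (hU : ∀ j, IsUpperSet (U j)) (m : Fin (k + 3)) (hZ : SuppZeroFlag (k + 2) (fun j => U (m.succAbove j))) :
    CombPos (fun _ : ι => k + 3) (fun p => sahiE (bernoulliWeight p) (k + 3) (fun j => ind (U j))) := by
  have hle : (fun _ : ι => k + 2) ≤ (fun _ : ι => k + 3) := fun _ => Nat.le_succ _
  have hmod : ∀ l : Fin (k + 2), CombPos (fun _ : ι => k + 2) (fun p => sahiE (bernoulliWeight p) (k + 2)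
      (fun j => ind (update (fun j => U (m.succAbove j)) l (U (m.succAbove l) ∩ U m) j))) := fun l =>
    hN ι _ (isUpperSet_update_inter hU m l)
  exact ((CombPos.sum univ fun l _ => hmod l).mono hle).congr fun p => sahiE_ind_step p U m hZ

/-! ### (R7′) the total-meet stratum -/

/-- **(M⁺-j)_{j ≤ k+2} ⇒ (M⁺-(k+3)) on the total-meet stratum.**  GIVEN `MasterFamilyCombPos j` for all `j ≤ k + 2`, a family of `k + 3`
increasing events with a member `U_m ⊇ ⋂_j U_{m.succAbove j}` has `E_{k+3}` comb-positive at multidegree `k + 3`: in the defect expansion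
`E_{k+3}(1_{U_m}, g) = (k+2 − P(U_m))·E_{k+2}(g) + Σ_{∅≠T⊊} |T|!·μ(⋂_T U ∖ U_m)·E_{|Tᶜ|}(g|Tᶜ) − (k+2)!·μ(⋂ U ∖ U_m)` the last defect vanishes
and every other term is a product of comb-positive factors. [this work] -/
theorem combPos_sahiE_ind_of_totalMeet {k : ℕ} (hN : ∀ j, j ≤ k + 2 → MasterFamilyCombPos j) (U : Fin (k + 3) → Set (Set ι))
    (hU : ∀ j, IsUpperSet (U j)) (m : Fin (k + 3)) (hmeet : (⋂ j, U (m.succAbove j)) ⊆ U m) :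
    CombPos (fun _ : ι => k + 3) (fun p => sahiE (bernoulliWeight p) (k + 3) (fun j => ind (U j))) := by
  obtain ⟨τ, hτ⟩ := exists_perm_forall_sahiE_ind_eq_cons U m
  set V : Fin (k + 2) → Set (Set ι) := fun j => U (m.succAbove (τ j)) with hV
  have hVup : ∀ j, IsUpperSet (V j) := fun j => hU _
  have hmeetV : (⋂ j, V j) ⊆ U m := by
    refine Set.Subset.trans (fun ω hω => Set.mem_iInter.2 fun j => ?_) hmeet
    have := Set.mem_iInter.1 hω (τ.symm j)
    simpa [hV] using this
  -- the defect integrands are nonnegative, and the total defect vanishes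
  have hdef_nonneg : ∀ (T : Finset (Fin (k + 2))) (ω : Set ι),
      0 ≤ ((1 - ind (U m)) * ∏ i ∈ T, ind (V i)) ω := fun T ω => by
    simp only [Pi.mul_apply, Pi.sub_apply, Pi.one_apply, Finset.prod_apply]
    exact mul_nonneg (sub_nonneg.2 (ind_le_one' (U m) ω)) (prod_nonneg fun i _ => ind_nonneg _ _)
  have hdef_top : (1 - ind (U m)) * ∏ i, ind (V i) = 0 := by
    funext ω
    simp only [Pi.mul_apply, Pi.sub_apply, Pi.one_apply, Finset.prod_apply, Pi.zero_apply]
    rw [prod_ind_eq_ind_iInter]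
    by_cases hω : ω ∈ ⋂ i, V i
    · rw [ind_of_mem hω, ind_of_mem (hmeetV hω)]; ring
    · rw [ind_of_not_mem hω, mul_zero]
  -- the pieces
  have hhead : CombPos (fun _ : ι => 1) (fun p => ((k + 1 : ℕ) : ℝ) + 1 - ex (bernoulliWeight p) (ind (U m))) := by
    refine (combPos_const_sub_ex (h := ind (U m)) (a := ((k + 1 : ℕ) : ℝ) + 1) fun ω => ?_).congr fun p => by ring
    have := ind_le_one' (U m) ω
    have hk : (0 : ℝ) ≤ ((k + 1 : ℕ) : ℝ) := Nat.cast_nonneg _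
    linarith
  have hg : CombPos (fun _ : ι => k + 2) (fun p => sahiE (bernoulliWeight p) (k + 2) (fun j => ind (V j))) :=
    hN (k + 2) le_rfl ι V hVup
  have hsub : ∀ T : Finset (Fin (k + 2)), CombPos (fun _ : ι => Tᶜ.card)
      (fun p => sahiE (bernoulliWeight p) Tᶜ.card (fun j => ind (V (Tᶜ.orderEmbOfFin rfl j)))) := fun T =>
    hN Tᶜ.card (by simpa using Finset.card_le_univ Tᶜ) ι (fun j => V (Tᶜ.orderEmbOfFin rfl j)) fun j => hVup _
  have hdefect : ∀ T : Finset (Fin (k + 2)), CombPos (fun _ : ι => 1)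
      (fun p => ex (bernoulliWeight p) ((1 - ind (U m)) * ∏ i ∈ T, ind (V i))) := fun T =>
    combPos_ex (hdef_nonneg T)
  have hdeg : (fun _ : ι => (1 : ℕ)) + (fun _ : ι => k + 2) = fun _ : ι => k + 3 := by
    funext e; simp only [Pi.add_apply]; omega
  have hterm : ∀ T ∈ (univ : Finset (Finset (Fin (k + 2)))).filter (fun T => T.Nonempty ∧ T ≠ univ),
      CombPos (fun _ : ι => k + 3) (fun p => ((T.card)! : ℝ) *
        (ex (bernoulliWeight p) ((1 - ind (U m)) * ∏ i ∈ T, ind (V i)) *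
          sahiE (bernoulliWeight p) Tᶜ.card (fun j => ind (V (Tᶜ.orderEmbOfFin rfl j))))) := by
    intro T _
    refine ((hdefect T).mul_of_le (hsub T) fun e => ?_).smul (Nat.cast_nonneg _)
    simp only [Pi.add_apply]
    have := Finset.card_le_univ Tᶜ
    simp only [Fintype.card_fin] at this
    omega
  have htot := ((hhead.mul_of_eq hg hdeg).add (CombPos.sum _ hterm)).add (CombPos.zero (fun _ : ι => k + 3))
  refine htot.congr fun p => ?_
  rw [hτ (bernoulliWeight p)]
  have hexp := SahiDefectExpansion.sahiE_cons_eq_defect_expansion (bernoulliWeight p) (k + 1) (ind (U m)) (fun j => ind (V j))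
  have hcons : (Matrix.vecCons (ind (U m)) fun j => ind (U (m.succAbove (τ j)))) =
      (Fin.cons (ind (U m)) (fun j => ind (V j)) : Fin (k + 1 + 2) → Set ι → ℝ) := rfl
  rw [hcons, hexp, hdef_top]
  have h0 : ex (bernoulliWeight p) (0 : Set ι → ℝ) = 0 := by simp [ex_def]
  have e2 : sahiE (bernoulliWeight p) (k + 1 + 1) (fun j => ind (V j)) =
      sahiE (bernoulliWeight p) (k + 2) (fun j => ind (V j)) := rfl
  rw [h0, e2]
  push_cast
  ring

/-! ### (R5₃) a cylinder member, order 3 -/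

/-- **`E_3` with a cylinder slot, decomposed**: for the cylinder `P = {ω | S ⊆ ω}` and events `A, B`,
`E_3(1_P, 1_A, 1_B) = P(P)·[Cov(A^S, B^S) + (P((A∩B)^S) − P(A∩B)) + (P(A^S) − P(A))·(P(B^S) − P(B))]`, `X^S = {ω | ω ∪ S ∈ X}`
(Blinovsky's three brackets [Blinovsky2013] in push-forward form: conditioning on `P` = freezing `S` to `1`). [this work] -/
theorem sahiE_three_cylinder_eq (p : ι → unitInterval) (S : Set ι) (A B : Set (Set ι)) :
    sahiE (bernoulliWeight p) 3 ![ind {ω : Set ι | S ⊆ ω}, ind A, ind B] =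
      ex (bernoulliWeight p) (ind {ω : Set ι | S ⊆ ω}) *
        (covFun (secUnion S A) (secUnion S B) p
          + (ex (bernoulliWeight p) (ind (secUnion S (A ∩ B))) - ex (bernoulliWeight p) (ind (A ∩ B)))
          + (ex (bernoulliWeight p) (ind (secUnion S A)) - ex (bernoulliWeight p) (ind A)) *
              (ex (bernoulliWeight p) (ind (secUnion S B)) - ex (bernoulliWeight p) (ind B))) := by
  have hPX : ∀ X : Set (Set ι), ex (bernoulliWeight p) (ind {ω : Set ι | S ⊆ ω} * ind X) =
      ex (bernoulliWeight p) (ind {ω : Set ι | S ⊆ ω}) * ex (bernoulliWeight p) (ind (secUnion S X)) := fun X => by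
    rw [mul_comm (ind _) (ind X), ex_ind_mul_ind_cylinder_eq, ex_ind_freeze_eq_secUnion, ex_ind_cylinder_eq_prod]
  have hAB : ind A * ind B = ind (A ∩ B) := funext fun ω =>
    (Literature.Probability.Percolation.BHK2006.ind_inter A B ω).symm
  have h3 : ind {ω : Set ι | S ⊆ ω} * ind A * ind B = ind {ω : Set ι | S ⊆ ω} * ind (A ∩ B) := by
    rw [mul_assoc, hAB]
  rw [sahiE_three, h3, hPX (A ∩ B), hPX B, hPX A, hAB]
  simp only [covFun, secUnion_inter]
  ring

/-- **(M⁺-3) with a cylinder slot at the head**: for a cylinder `P = {ω | S ⊆ ω}` and increasing `A, B`, `p ↦ E_3(μ_p; 1_P, 1_A, 1_B)` is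
comb-positive at multidegree `3` (from `sahiE_three_cylinder_eq`, (M⁺-2) for the set-sections and `CombPos.mul`). [this work] -/
theorem combPos_sahiE_three_cylinder_head (S : Set ι) {A B : Set (Set ι)} (hA : IsUpperSet A) (hB : IsUpperSet B) :
    CombPos (fun _ : ι => 3) (fun p => sahiE (bernoulliWeight p) 3 ![ind {ω : Set ι | S ⊆ ω}, ind A, ind B]) := by
  have hcov : CombPos (fun _ : ι => 2) (covFun (secUnion S A) (secUnion S B)) :=
    combPos_covFun _ _ (isUpperSet_secUnion S hA) (isUpperSet_secUnion S hB)
  have hAB : CombPos (fun _ : ι => 2)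
      (fun p => ex (bernoulliWeight p) (ind (secUnion S (A ∩ B))) - ex (bernoulliWeight p) (ind (A ∩ B))) :=
    (combPos_ex_secUnion_sub S (hA.inter hB)).mono fun _ => by norm_num
  have hdeg11 : (fun _ : ι => (1 : ℕ)) + (fun _ : ι => 1) = fun _ : ι => 2 := by funext e; simp
  have hprod : CombPos (fun _ : ι => 2)
      (fun p => (ex (bernoulliWeight p) (ind (secUnion S A)) - ex (bernoulliWeight p) (ind A)) *
        (ex (bernoulliWeight p) (ind (secUnion S B)) - ex (bernoulliWeight p) (ind B))) :=
    (combPos_ex_secUnion_sub S hA).mul_of_eq (combPos_ex_secUnion_sub S hB) hdeg11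
  have hdeg12 : (fun _ : ι => (1 : ℕ)) + (fun _ : ι => 2) = fun _ : ι => 3 := by funext e; simp
  have htot := (combPos_ex_ind {ω : Set ι | S ⊆ ω}).mul_of_eq ((hcov.add hAB).add hprod) hdeg12
  exact htot.congr fun p => sahiE_three_cylinder_eq p S A B

/-- **(M⁺-3) on the cylinder stratum**: three increasing events one of which is a cylinder `{ω | S ⊆ ω}` have `E_3` comb-positive at
multidegree `3`. [this work] -/
theorem combPos_sahiE_three_cylinder (U : Fin 3 → Set (Set ι)) (hU : ∀ j, IsUpperSet (U j)) (m : Fin 3) (S : Set ι)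
    (hm : U m = {ω : Set ι | S ⊆ ω}) :
    CombPos (fun _ : ι => 3) (fun p => sahiE (bernoulliWeight p) 3 (fun j => ind (U j))) := by
  obtain ⟨τ, hτ⟩ := exists_perm_forall_sahiE_ind_eq_cons U m
  have hfam : (Matrix.vecCons (ind (U m)) fun j => ind (U (m.succAbove (τ j)))) =
      ![ind {ω : Set ι | S ⊆ ω}, ind (U (m.succAbove (τ 0))), ind (U (m.succAbove (τ 1)))] := by
    rw [hm]
    congr 1
    funext j
    fin_cases j <;> rfl
  exact (combPos_sahiE_three_cylinder_head S (hU _) (hU _)).congr fun p => by rw [hτ (bernoulliWeight p), hfam]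

/-! ### Assembly at order 3: (M⁺-3) off the residual class, unconditionally -/

/-- **(M⁺-3) OFF THE RESIDUAL CLASS, unconditionally.**  For three increasing events of a finite cube with
(R4) a comparable pair, OR (R5) a cylinder member `{ω | S ⊆ ω}`, OR (R3) a member determined by a coordinate set `F` while the other two
are determined by `Fᶜ`, OR (R6) the other two members determined by disjoint coordinate sets (`Z_2`), OR (R7′) a member containing the
intersection of the other two, the function `p ↦ E_3(μ_p; 1_{U_0},1_{U_1},1_{U_2})` is a nonnegative combination of the degree-3
tensor-Bernstein basis `∏_e p_e^{j_e}(1−p_e)^{3−j_e}` — the coefficientwise (three-partition / three-copy fibre) form of Kahn's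
Conjecture 5 holds there.  Ingredients: (M⁺-2) (`masterFamilyCombPos_two`, law of total covariance) and the all-`k` identities above.
[this work] -/
theorem combPos_sahiE_three_of_not_residual (U : Fin 3 → Set (Set ι)) (hU : ∀ j, IsUpperSet (U j))
    (h : (∃ i j : Fin 3, j ≠ i ∧ U j ⊆ U i) ∨ (∃ (m : Fin 3) (S : Set ι), U m = {ω : Set ι | S ⊆ ω}) ∨
      (∃ (m : Fin 3) (F : Finset ι), DeterminedBy (U m) (↑F : Set ι) ∧ ∀ j, DeterminedBy (U (m.succAbove j)) (↑F : Set ι)ᶜ) ∨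
      (∃ m : Fin 3, SuppZeroFlag 2 (fun j => U (m.succAbove j))) ∨
      (∃ m : Fin 3, (⋂ j, U (m.succAbove j)) ⊆ U m)) :
    CombPos (fun _ : ι => 3) (fun p => sahiE (bernoulliWeight p) 3 (fun j => ind (U j))) := by
  rcases h with ⟨i, j, hij, hsub⟩ | ⟨m, S, hm⟩ | ⟨m, F, hF, hFc⟩ | ⟨m, hZ⟩ | ⟨m, hmeet⟩
  · exact combPos_sahiE_ind_of_subset' masterFamilyCombPos_two U hU hij hsub
  · exact combPos_sahiE_three_cylinder U hU m S hm
  · exact combPos_sahiE_ind_of_indepMember masterFamilyCombPos_two U hU m F hF hFc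
  · exact combPos_sahiE_ind_of_zeroFlag masterFamilyCombPos_two U hU m hZ
  · exact combPos_sahiE_ind_of_totalMeet (fun j hj => masterFamilyCombPos_of_le_two hj) U hU m hmeet

/-- Law-level corollary (a second route to the tree's `sahiE_three_ind_nonneg_of_not_residual`, now through comb positivity):
`E_3(μ_p; 1_U) ≥ 0` on the five strata, every `p ∈ [0,1]^ι`. [this work] -/
theorem sahiE_three_ind_nonneg_of_not_residual_comb (p : ι → unitInterval) (U : Fin 3 → Set (Set ι)) (hU : ∀ j, IsUpperSet (U j))
    (h : (∃ i j : Fin 3, j ≠ i ∧ U j ⊆ U i) ∨ (∃ (m : Fin 3) (S : Set ι), U m = {ω : Set ι | S ⊆ ω}) ∨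
      (∃ (m : Fin 3) (F : Finset ι), DeterminedBy (U m) (↑F : Set ι) ∧ ∀ j, DeterminedBy (U (m.succAbove j)) (↑F : Set ι)ᶜ) ∨
      (∃ m : Fin 3, SuppZeroFlag 2 (fun j => U (m.succAbove j))) ∨
      (∃ m : Fin 3, (⋂ j, U (m.succAbove j)) ⊆ U m)) :
    0 ≤ sahiE (bernoulliWeight p) 3 (fun j => ind (U j)) :=
  (combPos_sahiE_three_of_not_residual U hU h).nonneg p

/-- Density-free zeros on the five strata: if `E_3(μ_q; 1_U) = 0` at one interior `q` then `E_3(μ_p; 1_U) = 0` for all `p`. [this work] -/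
theorem sahiE_three_ind_eq_zero_of_interior_zero_of_not_residual (U : Fin 3 → Set (Set ι)) (hU : ∀ j, IsUpperSet (U j))
    (h : (∃ i j : Fin 3, j ≠ i ∧ U j ⊆ U i) ∨ (∃ (m : Fin 3) (S : Set ι), U m = {ω : Set ι | S ⊆ ω}) ∨
      (∃ (m : Fin 3) (F : Finset ι), DeterminedBy (U m) (↑F : Set ι) ∧ ∀ j, DeterminedBy (U (m.succAbove j)) (↑F : Set ι)ᶜ) ∨
      (∃ m : Fin 3, SuppZeroFlag 2 (fun j => U (m.succAbove j))) ∨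
      (∃ m : Fin 3, (⋂ j, U (m.succAbove j)) ⊆ U m))
    {q : ι → unitInterval} (hq : ∀ e, (q e : ℝ) ∈ Set.Ioo (0 : ℝ) 1)
    (h0 : sahiE (bernoulliWeight q) 3 (fun j => ind (U j)) = 0) (p : ι → unitInterval) :
    sahiE (bernoulliWeight p) 3 (fun j => ind (U j)) = 0 :=
  (combPos_sahiE_three_of_not_residual U hU h).eq_zero_of_interior hq h0 p

/-! ### The typed all-`k` step at the comb level (four strata) -/

/-- **The comb-level `k → k+1` step off the residual class, every `k`.**  GIVEN (M⁺-j) for all `j ≤ k + 2`, a family of `k + 3` increasing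
events with a comparable pair, OR an independent member, OR a deleted family in `Z_{k+2}`, OR a member containing the intersection of all
the others, has `E_{k+3}` comb-positive at multidegree `k + 3`.  (The cylinder stratum for general `k` is not included.) [this work] -/
theorem combPos_sahiE_ind_of_not_residual {k : ℕ} (hN : ∀ j, j ≤ k + 2 → MasterFamilyCombPos j)
    (U : Fin (k + 3) → Set (Set ι)) (hU : ∀ j, IsUpperSet (U j))
    (h : (∃ i j : Fin (k + 3), j ≠ i ∧ U j ⊆ U i) ∨
      (∃ (m : Fin (k + 3)) (F : Finset ι), DeterminedBy (U m) (↑F : Set ι) ∧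
        ∀ j, DeterminedBy (U (m.succAbove j)) (↑F : Set ι)ᶜ) ∨
      (∃ m : Fin (k + 3), SuppZeroFlag (k + 2) (fun j => U (m.succAbove j))) ∨
      (∃ m : Fin (k + 3), (⋂ j, U (m.succAbove j)) ⊆ U m)) :
    CombPos (fun _ : ι => k + 3) (fun p => sahiE (bernoulliWeight p) (k + 3) (fun j => ind (U j))) := by
  rcases h with ⟨i, j, hij, hsub⟩ | ⟨m, F, hF, hFc⟩ | ⟨m, hZ⟩ | ⟨m, hmeet⟩
  · exact combPos_sahiE_ind_of_subset' (hN _ le_rfl) U hU hij hsub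
  · exact combPos_sahiE_ind_of_indepMember (hN _ le_rfl) U hU m F hF hFc
  · exact combPos_sahiE_ind_of_zeroFlag (hN _ le_rfl) U hU m hZ
  · exact combPos_sahiE_ind_of_totalMeet hN U hU m hmeet

end Summit.CriticalPhenomena.PercolationContinuityZ3.Theorems
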